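import Mathlib.Data.Fintype.Fin
import HarnessLib

/-!
# Cell qa-qnc0 (rung F-Q1, route RingFrame, crux α, line `tensor`): the `𝔽₂⁴` check of
# qn-p2's Proposition B (B2)/(iv) — the "axes union" contains no affine 2-flat

Ask X3 of HOME/qa-qnc0-p2/ROUND-2.md §12b: in `𝔽₂⁴` with coordinates `(x₁, x₂, x₃, x₄)` let
`A = {x₁ = x₂ = 0}`, `B = {x₃ = x₄ = 0}`.  The six-point set `(A ∪ B) ∖ {0}` contains no affine
2-flat `{a, a + v, a + w, a + v + w}` (`v, w ≠ 0`, `v ≠ w`).  (Prose reason: a 2-flat `{a,a',b,b'}`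
inside it would need `a + a' = b + b'` with `a + a' ∈ A ∖ 0`, `b + b' ∈ B ∖ 0`, impossible as
`A ∩ B = 0`; here it is a finite check by `decide`.)  Used in the adjacency step (B2) of the
boundary-structure Proposition B of the tensor line (qn-p2 ROUND-2 §7b).

* `axesUnion_noTwoFlat_bits`: the statement over bitmasks `Fin 16` (xor = vector addition).

The cell's statement (qn-p2, ask X3); finite check.  WHAT THIS IS NOT: nothing on Proposition B
itself, on `TRPlus` or on α; no separation.
-/

namespace Summit.QuantumAdvantage.AdviceFreeQNC0

/-- **X3 (qn-p2 ROUND-2 §12b): the six-point set `({x₁ = x₂ = 0} ∪ {x₃ = x₄ = 0}) ∖ {0} ⊂ 𝔽₂⁴`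
contains no affine 2-flat** `{a, a + v, a + w, a + v + w}` (`v ≠ 0`, `w ≠ 0`, `v ≠ w`).  Points of
`𝔽₂⁴` are bitmasks `x < 16` (bit `i − 1` = coordinate `xᵢ`, addition = xor), membership in
`(A ∪ B) ∖ {0}` is `x ≠ 0 ∧ (x &&& 3 = 0 ∨ x &&& 12 = 0)`.  Finite check by `decide`.
(Cell statement, qn-p2 Proposition B (B2)(iv).) -/
theorem axesUnion_noTwoFlat_bits :
    ∀ a v w : Fin 16, v.val ≠ 0 → w.val ≠ 0 → v ≠ w →
      ¬ ((a.val ≠ 0 ∧ (a.val &&& 3 = 0 ∨ a.val &&& 12 = 0)) ∧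
         ((a.val ^^^ v.val) ≠ 0 ∧ ((a.val ^^^ v.val) &&& 3 = 0 ∨ (a.val ^^^ v.val) &&& 12 = 0)) ∧
         ((a.val ^^^ w.val) ≠ 0 ∧ ((a.val ^^^ w.val) &&& 3 = 0 ∨ (a.val ^^^ w.val) &&& 12 = 0)) ∧
         ((a.val ^^^ v.val ^^^ w.val) ≠ 0 ∧
           ((a.val ^^^ v.val ^^^ w.val) &&& 3 = 0 ∨ (a.val ^^^ v.val ^^^ w.val) &&& 12 = 0))) := by
  decide

end Summit.QuantumAdvantage.AdviceFreeQNC0
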